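import Mathlib
import Summits.ValiantsHypothesis.ValiantsHypothesis.Theorems.PermanentalConesPermanentalConeHardFlagStep

/-!
# `PermanentalConeHard` (stmt-ValiantsHypothesis-8654) — the iterated flag description

Companion of `PermanentalConesPermanentalConeHardFlagStep.lean`.  Iterating the flag step
`Λ₊₊(Q, 𝟙) = {Q > 0} ∩ Λ₊₊(∂ⱼQ, 𝟙)` along an elimination order `l = [j₁, …, j_m]` (derivatives
`D_l Q = ∂_{j_m} ⋯ ∂_{j₁} Q`, `List.foldl`) gives, for a real stable multi-affine form `Q` with
nonnegative coefficients and `D_l Q ≠ 0`,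

  `Λ₊₊(Q, 𝟙) = {x : (D_{l.take k} Q)(x) > 0 for all k < m} ∩ Λ₊₊(D_l Q, 𝟙)`

(`openHyperbolicityCone_eq_flagChain`).  When `D_l Q` is a (positive) constant the last cone is
everything, so `Λ₊₊(Q, 𝟙)` is cut out by the `m = deg Q` polynomial inequalities of the flag — the
"`d` nested coordinate derivatives" description of the permanental witness cones recorded in
`Cruxes/PermanentalConeHard/CORE-analysis-c4.md`.
-/

set_option linter.dupNamespace false

noncomputable section

namespace Summit.ValiantsHypothesis.ValiantsHypothesis.Theorems.PermanentalConesPermanentalConeHard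

open MvPolynomial Finset
open scoped BigOperators
open Literature.AlgebraicGeometry.HyperbolicPolynomials
open Literature.Combinatorics.StablePolynomials

variable {σ : Type*} [Fintype σ] [DecidableEq σ]

/-! ### The class is stable under iterated coordinate derivatives -/

section Chain

variable {Q : MvPolynomial σ ℝ} {d : ℕ}

omit [Fintype σ] [DecidableEq σ] in
/-- A nonzero iterated derivative has nonzero shorter iterates. [folklore] -/
theorem foldl_pderiv_ne_zero_of_append {l : List σ} {i : σ}
    (h : (l ++ [i]).foldl (fun q k => pderiv k q) Q ≠ 0) :
    l.foldl (fun q k => pderiv k q) Q ≠ 0 := by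
  intro h0
  apply h
  rw [List.foldl_append, List.foldl_cons, List.foldl_nil, h0, map_zero]

omit [Fintype σ] [DecidableEq σ] in
/-- Iterated derivatives keep multi-affinity. [folklore] -/
theorem isMultiAffine_foldl_pderiv (hma : IsMultiAffine Q) (l : List σ) :
    IsMultiAffine (l.foldl (fun q k => pderiv k q) Q) := by
  induction l using List.reverseRecOn with
  | nil => simpa using hma
  | append_singleton l i ih =>
    rw [List.foldl_append, List.foldl_cons, List.foldl_nil]
    exact isMultiAffine_pderiv ih i

omit [Fintype σ] [DecidableEq σ] in
/-- Iterated derivatives keep nonnegative coefficients. [folklore] -/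
theorem coeff_foldl_pderiv_nonneg (hcoef : ∀ m, 0 ≤ Q.coeff m) (l : List σ) :
    ∀ m, 0 ≤ (l.foldl (fun q k => pderiv k q) Q).coeff m := by
  induction l using List.reverseRecOn with
  | nil => simpa using hcoef
  | append_singleton l i ih =>
    rw [List.foldl_append, List.foldl_cons, List.foldl_nil]
    exact coeff_pderiv_nonneg ih i

omit [Fintype σ] [DecidableEq σ] in
/-- Iterated derivatives of a form of degree `d` along `l` are forms of degree `d - l.length`.
[folklore] -/
theorem isHomogeneous_foldl_pderiv (hhom : Q.IsHomogeneous d) (l : List σ) :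
    (l.foldl (fun q k => pderiv k q) Q).IsHomogeneous (d - l.length) := by
  induction l using List.reverseRecOn with
  | nil => simpa using hhom
  | append_singleton l i ih =>
    rw [List.foldl_append, List.foldl_cons, List.foldl_nil, List.length_append, List.length_singleton,
      ← Nat.sub_sub]
    exact isHomogeneous_pderiv' ih i

/-- Nonzero iterated derivatives of a real stable polynomial are real stable.
[cite: Wagner2011, Lemma 2.4 (f)] -/
theorem isRealStable_foldl_pderiv (hst : IsRealStable Q) :
    ∀ l : List σ, l.foldl (fun q k => pderiv k q) Q ≠ 0 →
      IsRealStable (l.foldl (fun q k => pderiv k q) Q) := by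
  intro l
  induction l using List.reverseRecOn with
  | nil => intro _; simpa using hst
  | append_singleton l i ih =>
    intro hne
    have hne' := foldl_pderiv_ne_zero_of_append hne
    rw [List.foldl_append, List.foldl_cons, List.foldl_nil] at hne ⊢
    exact isRealStable_pderiv (ih hne') hne

/-- **ITERATED FLAG DESCRIPTION.**  For a real stable multi-affine form `Q` with nonnegative
coefficients and an elimination order `l` with `D_l Q ≠ 0`:
`Λ₊₊(Q, 𝟙) = {x : (D_{l.take k} Q)(x) > 0 ∀ k < l.length} ∩ Λ₊₊(D_l Q, 𝟙)`.
[cite: Branden2007, §5, Theorem 5.6] -/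
theorem openHyperbolicityCone_eq_flagChain (hhom : Q.IsHomogeneous d) (hma : IsMultiAffine Q)
    (hcoef : ∀ m, 0 ≤ Q.coeff m) (hst : IsRealStable Q) :
    ∀ l : List σ, l.foldl (fun q k => pderiv k q) Q ≠ 0 →
      openHyperbolicityCone Q (fun _ => (1 : ℝ)) =
        {x | ∀ k < l.length, 0 < MvPolynomial.eval x ((l.take k).foldl (fun q k => pderiv k q) Q)} ∩
          openHyperbolicityCone (l.foldl (fun q k => pderiv k q) Q) (fun _ => (1 : ℝ)) := by
  intro l
  induction l using List.reverseRecOn with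
  | nil =>
    intro _
    ext x
    simp
  | append_singleton l i ih =>
    intro hne
    have hne' := foldl_pderiv_ne_zero_of_append hne
    have hstep := openHyperbolicityCone_eq_inter_pderiv (isHomogeneous_foldl_pderiv hhom l)
      (isMultiAffine_foldl_pderiv hma l) (coeff_foldl_pderiv_nonneg hcoef l)
      (isRealStable_foldl_pderiv hst l hne') (j := i)
      (by rwa [List.foldl_append, List.foldl_cons, List.foldl_nil] at hne)
    rw [ih hne', hstep]
    ext x
    simp only [Set.mem_inter_iff, Set.mem_setOf_eq, List.length_append, List.length_singleton]
    constructor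
    · rintro ⟨hk, hpos, hmem⟩
      refine ⟨fun k hk' => ?_, ?_⟩
      · rcases Nat.lt_succ_iff_lt_or_eq.mp hk' with hlt | heq
        · rw [List.take_append_of_le_length hlt.le]
          exact hk k hlt
        · subst heq
          rw [List.take_left]
          exact hpos
      · rwa [List.foldl_append, List.foldl_cons, List.foldl_nil]
    · rintro ⟨hk, hmem⟩
      refine ⟨fun k hk' => ?_, ?_, ?_⟩
      · have := hk k (Nat.lt_succ_of_lt hk')
        rwa [List.take_append_of_le_length hk'.le] at this
      · have := hk l.length (Nat.lt_succ_self _)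
        rwa [List.take_left] at this
      · rwa [List.foldl_append, List.foldl_cons, List.foldl_nil] at hmem

end Chain

/-- **Registered form** (`stub_flagChain` on stmt-ValiantsHypothesis-8654): the iterated flag
description, verbatim signature. -/
theorem stub_flagChain : ∀ (σ : Type) [Fintype σ] [DecidableEq σ] (Q : MvPolynomial σ ℝ) (d : ℕ), Q.IsHomogeneous d → Literature.Combinatorics.StablePolynomials.IsMultiAffine Q → (∀ m, 0 ≤ Q.coeff m) → Literature.Combinatorics.StablePolynomials.IsRealStable Q → ∀ l : List σ, l.foldl (fun q k => MvPolynomial.pderiv k q) Q ≠ 0 → Literature.AlgebraicGeometry.HyperbolicPolynomials.openHyperbolicityCone Q (fun _ => (1 : ℝ)) = {x | ∀ k < l.length, 0 < MvPolynomial.eval x ((l.take k).foldl (fun q k => MvPolynomial.pderiv k q) Q)} ∩ Literature.AlgebraicGeometry.HyperbolicPolynomials.openHyperbolicityCone (l.foldl (fun q k => MvPolynomial.pderiv k q) Q) (fun _ => (1 : ℝ)) := by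
  intro σ _ _ Q d hhom hma hcoef hst l hl
  exact openHyperbolicityCone_eq_flagChain hhom hma hcoef hst l hl

end Summit.ValiantsHypothesis.ValiantsHypothesis.Theorems.PermanentalConesPermanentalConeHard
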